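import Summits.ResolutionOfSingularities.ResolutionOfSingularities.Theorems.PurelyInseparableDim4ResConeCInfLayerPrime
import HarnessLib
import HarnessLib.Audit.Tags

/-!
# Purely inseparable four-folds — KILLERS of the flagless branch, every prime: a line TOP is carried by every translated slot step; a
# `κ`-killer `x_j^{a+1}x_i²x_u^{d−c−a}x_f^c` (`a ≥ 2`) of a flagless state forbids EVERY `κ`-step and survives EVERY `o`-step; the ♯-flag
# `x_j³x_i³x_u^{d−2}` is carried in regime R (cell `res-dim4-pi`, K2(p) lane, power-cone light-pair line, flagless branch, FILE ♯3)

[OURS · counted 0 · cell `res-dim4-pi` · K2(p) lane (holder res-dim4-p-12 g5); seat res-dim4-p-3 g6 (MEMO `res-dim4-p-3/MEMO-g6-FLAGLESS-SHARP.md`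
(F3), (U♯)).]  Nothing here proves K2(p) for any `p`, any TAIL(p, p−1, 3), `NoIsolatedTrap p p`, the Cossart–Jannsen–Saito theorem or resolution of
singularities in dimension ≥ 4 / characteristic `p` — NOT proved.  AI kernel work, weaker than expert review.  Exponent algebra of OUR frame.

F-exponents `(e_j, e_i, e_u, e_f)`; `d + 1 = p`.
* §1 **`coeff_top_step_translate_u`** — if `E_j = n`, `|E| = p + n` and every parent monomial on the line of `E` (`|δ| = p + n`, `δ_i = E_i`,
  `δ_f = E_f`) has `δ_j ≥ n`, then `E` is the TOP of its line and its coefficient is CARRIED by the slot step in the chart of `j` translated by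
  ANY `β·e_u` (♯1's flag invariance is `n = 2` with the exact ledger; the ♯-flag `x_j³x_i³x_u^{d−2}` of regime R is `n = 3`:
  **`coeff_sharpFlag_step_translate_u`**).
* §2 **`not_regime_step_translate_u_of_killer`** (MEMO (F3)) — a FLAGLESS straight exact-ledger state carrying a `κ`-KILLER
  `x_j^{a+1}x_i²x_u^{d−c−a}x_f^c` (`2 ≤ a ≤ d − c`, `c + 2 ≤ d`) has NO in-regime `κ`-child for ANY translation `β`: the killer's `κ`-line is the flag
  line, whose Hasse sums would all be child coefficients below degree `d + 3` or the (zero) flag.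
* §3 **`coeff_killer_step_translate_other`** — the same killer is CARRIED by every `o`-step (any `β′`): it is the top of its `o`-line.  So a killer
  freezes the chart to `o` for ever — impossible in an infinite isolated chain by the free-tail lemma (`noIsolatedFreeTailAt_self`).
[cite: Hauser2010, §§F–G] [cite: CossartJannsenSaito2020, Lemma 13.2, Thm. 3.14]
bears_on: LADDER-RESOLUTION:D157-DOOR2 (res-dim4-pi · K2(p) · power cones · flagless branch ♯3).  Supports
stmt-ResolutionOfSingularities-16155 (helper).
-/

set_option linter.dupNamespace false -- mandated namespace of this single-conjunct summit

noncomputable section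

namespace Summit.ResolutionOfSingularities.ResolutionOfSingularities.Theorems.PIDim4

namespace ResCone

open MvPolynomial Finset
open Literature.AlgebraicGeometry.Resolution
open Literature.AlgebraicGeometry.Resolution.CentreBlowup
open Literature.AlgebraicGeometry.Resolution.Hauser2010
open Literature.AlgebraicGeometry.Resolution.HauserPerlega2019

variable {K : Type} [Field K] [DecidableEq K]

section Step

variable {j i u f : Fin 4} (hji : j ≠ i) (hju : j ≠ u) (hjf : j ≠ f) (hiu : i ≠ u) (hif : i ≠ f) (huf : u ≠ f)
include hji hju hjf hiu hif huf

/-! ## 1. The top of a line is carried by every translated slot step -/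

/-- **THE TOP OF A LINE IS CARRIED** by the slot step in the chart of `j` translated by ANY `β·e_u`: if `E_j = n`, `|E| = p + n`, `E` is not a
`p`-th power exponent, and every parent monomial `δ` with `|δ| = p + n`, `δ_i = E_i`, `δ_f = E_f` has `n ≤ δ_j` (so `δ_u ≤ E_u`), then
`coeff E (child) = coeff E (parent)`. [OURS] [cite: Hauser2010, §§F–G] -/
theorem coeff_top_step_translate_u (p : ℕ) (s : State K) (hq : ((p : ℕ) : ℕ∞) ≤ ordAlong Finset.univ s.F) (β : K)
    {E : Fin 4 →₀ ℕ} {n : ℕ} (hEj : E j = n) (hdeg : E.degree = p + n) (hnp : ¬ IsPthPowerExponent p E)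
    (hmin : ∀ δ ∈ s.F.support, δ.degree = p + n → δ i = E i → δ f = E f → n ≤ δ j) :
    coeff E (CentreBlowup.step p Finset.univ j (Function.update (0 : Fin 4 → K) u β) s).F = coeff E s.F := by
  classical
  set γ : Fin 4 →₀ ℕ := E.erase j with hγ
  have hγj : γ j = 0 := by rw [hγ, Finsupp.erase_same]
  have hEγ : E = γ + Finsupp.single j (p + n - p) := by rw [Nat.add_sub_cancel_left, hγ, ← hEj, Finsupp.erase_add_single]
  have hγi : γ i = E i := by rw [hγ, Finsupp.erase_ne hji.symm]
  have hγu : γ u = E u := by rw [hγ, Finsupp.erase_ne hju.symm]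
  have hγf : γ f = E f := by rw [hγ, Finsupp.erase_ne hjf.symm]
  have hEq := degree_eq_quad hji hju hjf hiu hif huf E
  rw [hEγ] at hnp
  rw [hEγ, coeff_step_translate_u hji hju hjf hiu hif huf p s hq β (Nat.le_add_right p n) γ hγj hnp, ← hEγ]
  rw [Finset.sum_eq_single E]
  · rw [hγu, Nat.choose_self, Nat.sub_self, pow_zero, Nat.cast_one, one_mul, one_mul]
  · intro δ hδ hne
    rw [Finset.mem_filter] at hδ
    obtain ⟨hmem, hm, hi, hf⟩ := hδ
    have hδj := hmin δ hmem hm (hi.trans hγi) (hf.trans hγf)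
    have hδq := degree_eq_quad hji hju hjf hiu hif huf δ
    rcases Nat.lt_or_ge (δ u) (γ u) with hlt | hge
    · rw [Nat.choose_eq_zero_of_lt hlt, Nat.cast_zero, zero_mul, zero_mul]
    · exfalso
      apply hne
      rw [hγu] at hge
      rw [hγi] at hi
      rw [hγf] at hf
      exact eq_of_line_of_apply_u_eq hji hju hjf hiu hif huf hm hdeg hi hf (by omega)
  · intro hnot
    by_cases h0 : coeff E s.F = 0
    · rw [h0, mul_zero]
    · exfalso
      exact hnot (Finset.mem_filter.mpr ⟨mem_support_iff.mpr h0, hdeg, hγi.symm, hγf.symm⟩)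

/-- **THE ♯-FLAG IS CARRIED in regime R** (`d + 1 = p`, `4 ≤ d`): if every `f`-free parent monomial has `e_j ≥ 3` (residual `κ`-exponent
`≥ 2`), the coefficient `g` of `x_j³x_i³x_u^{d−2}` — the residual `κ²o²u^{d−2}`, isolation's u-witness of the flagless branch — is carried by the slot
step in the chart of `j` translated by ANY `β·e_u`. [OURS] [cite: Hauser2010, §§F–G] -/
theorem coeff_sharpFlag_step_translate_u (p : ℕ) {d : ℕ} (hdp : d + 1 = p) (hd4 : 4 ≤ d) (s : State K)
    (hq : ((p : ℕ) : ℕ∞) ≤ ordAlong Finset.univ s.F) (hR : ∀ e ∈ s.F.support, e f = 0 → 3 ≤ e j) (β : K) :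
    coeff (Finsupp.single j 3 + Finsupp.single i 3 + Finsupp.single u (d - 2) + Finsupp.single f 0)
        (CentreBlowup.step p Finset.univ j (Function.update (0 : Fin 4 → K) u β) s).F =
      coeff (Finsupp.single j 3 + Finsupp.single i 3 + Finsupp.single u (d - 2) + Finsupp.single f 0) s.F := by
  obtain ⟨h1, h2, h3, h4⟩ := quad_apply hji hju hjf hiu hif huf 3 3 (d - 2) 0
  refine coeff_top_step_translate_u hji hju hjf hiu hif huf p s hq β h1 (by rw [degree_quad]; omega) ?_ ?_
  · rw [isPthPowerExponent_iff]
    intro h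
    have := Nat.le_of_dvd (by norm_num) (h2 ▸ h i)
    omega
  · intro δ hδ _ _ hf
    exact hR δ hδ (by rw [hf, h4])

/-! ## 2. A `κ`-killer of a flagless state forbids every `κ`-step -/

/-- **A `κ`-KILLER FORBIDS EVERY `κ`-STEP** (MEMO (F3); `d + 1 = p`, `2 ≤ d`).  Parent `s`: order `≥ d + 2`, straight, exact ledger, FLAGLESS
at contact exponent `c` (`coeff x_j²x_i²x_u^{d−1−c}x_f^c = 0`, `c + 2 ≤ d`), carrying the killer `x_j^{a+1}x_i²x_u^{d−c−a}x_f^c` (`2 ≤ a ≤ d − c`).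
Then for EVERY `β` the child of the slot step in the chart of `j` translated by `β·e_u` is NOT in regime: some child monomial of degree
`< d + 3` other than the cone survives. [OURS] [cite: Hauser2010, §§F–G] [cite: CossartJannsenSaito2020, Thm. 3.14] -/
theorem not_regime_step_translate_u_of_killer (p : ℕ) [hp : Fact p.Prime] {d : ℕ} (hdp : d + 1 = p) (hd2 : 2 ≤ d) (s : State K)
    (hq : ((p : ℕ) : ℕ∞) ≤ ordAlong Finset.univ s.F)
    (hled : ∀ e ∈ s.F.support, e f ≤ d - 1 → 2 ≤ e j ∧ 2 ≤ e i) {a c : ℕ} (hac : a ≤ d - c) (hc : c + 2 ≤ d)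
    (hflag : coeff (Finsupp.single j 2 + Finsupp.single i 2 + Finsupp.single u (d - 1 - c) + Finsupp.single f c) s.F = 0)
    (hkill : coeff (Finsupp.single j (a + 1) + Finsupp.single i 2 + Finsupp.single u (d - c - a) + Finsupp.single f c) s.F ≠ 0)
    (β : K) :
    ¬ (∀ E ∈ (CentreBlowup.step p Finset.univ j (Function.update (0 : Fin 4 → K) u β) s).F.support,
        d + 3 ≤ E.degree ∨ E = Finsupp.single j 1 + Finsupp.single i 1 + Finsupp.single u 0 + Finsupp.single f d) := by
  classical
  intro hreg
  have hp3 : 3 ≤ p := by have := hp.out.two_le; omega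
  set s₁ := CentreBlowup.step p Finset.univ j (Function.update (0 : Fin 4 → K) u β) s with hs₁
  obtain ⟨hKj, hKi, hKu, hKf⟩ := quad_apply hji hju hjf hiu hif huf (a + 1) 2 (d - c - a) c
  -- the `κ`-line of the killer: `|δ| = d + 3`, `δ_i = 2`, `δ_f = c`; members have `δ_j ≥ 2`, so `δ_u ≤ d − 1 − c`
  have htop : ∀ δ ∈ s.F.support, δ.degree = d + 3 → δ i = 2 → δ f = c → δ u ≤ d - 1 - c := by
    intro δ hδ hm hi hf
    have h2 := (hled δ hδ (by omega)).1
    have := degree_eq_quad hji hju hjf hiu hif huf δ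
    omega
  have hvan : ∀ J, J ≤ d - 1 - c →
      ∑ δ ∈ s.F.support with (δ.degree = d + 3 ∧ δ i = 2 ∧ δ f = c),
        ((δ u).choose J : K) * β ^ (δ u - J) * coeff δ s.F = 0 := by
    intro J hJ
    set γ : Fin 4 →₀ ℕ := Finsupp.single i 2 + Finsupp.single u J + Finsupp.single f c with hγ
    have hγj : γ j = 0 := by
      rw [hγ, Finsupp.add_apply, Finsupp.add_apply, Finsupp.single_eq_of_ne hji, Finsupp.single_eq_of_ne hju,
        Finsupp.single_eq_of_ne hjf]; simp
    have hγi : γ i = 2 := by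
      rw [hγ, Finsupp.add_apply, Finsupp.add_apply, Finsupp.single_eq_same, Finsupp.single_eq_of_ne hiu,
        Finsupp.single_eq_of_ne hif]; simp
    have hγu : γ u = J := by
      rw [hγ, Finsupp.add_apply, Finsupp.add_apply, Finsupp.single_eq_of_ne hiu.symm, Finsupp.single_eq_same,
        Finsupp.single_eq_of_ne huf]; simp
    have hγf : γ f = c := by
      rw [hγ, Finsupp.add_apply, Finsupp.add_apply, Finsupp.single_eq_of_ne hif.symm, Finsupp.single_eq_of_ne huf.symm,
        Finsupp.single_eq_same]; simp
    have hnp : ¬ IsPthPowerExponent p (γ + Finsupp.single j (d + 3 - p)) := by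
      rw [isPthPowerExponent_iff]
      intro h
      have h2 := h j
      rw [Finsupp.add_apply, hγj, zero_add, Finsupp.single_eq_same, show d + 3 - p = 2 by omega] at h2
      have := Nat.le_of_dvd (by norm_num) h2
      omega
    have key := coeff_step_translate_u hji hju hjf hiu hif huf p s hq β (show p ≤ d + 3 by omega) γ hγj hnp
    simp only [hγi, hγu, hγf] at key
    rw [← key]
    rcases Nat.lt_or_ge J (d - 1 - c) with hlt | hge
    · -- below degree `d + 3` and not the cone: absent from the in-regime child
      refine notMem_support_iff.mp fun hmem₁ => ?_
      rcases hreg _ hmem₁ with hge | hcone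
      · have hdegγ : (γ + Finsupp.single j (d + 3 - p)).degree = 2 + J + c + (d + 3 - p) := by
          rw [map_add, Finsupp.degree_single, hγ, map_add, map_add, Finsupp.degree_single, Finsupp.degree_single,
            Finsupp.degree_single]
        rw [hdegγ] at hge
        omega
      · have hj2 : (γ + Finsupp.single j (d + 3 - p)) j =
            (Finsupp.single j 1 + Finsupp.single i 1 + Finsupp.single u 0 + Finsupp.single f d : Fin 4 →₀ ℕ) j := by
          rw [hcone]
        rw [Finsupp.add_apply, hγj, Finsupp.single_eq_same, (quad_apply hji hju hjf hiu hif huf 1 1 0 d).1] at hj2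
        omega
    · -- the top sum is the child's flag, equal to the parent's flag, which is zero
      have hJ' : J = d - 1 - c := le_antisymm hJ hge
      have hexp : γ + Finsupp.single j (d + 3 - p) =
          Finsupp.single j 2 + Finsupp.single i 2 + Finsupp.single u (d - 1 - c) + Finsupp.single f c := by
        rw [show d + 3 - p = 2 by omega, hγ, hJ']
        abel
      rw [hexp, coeff_flag_step_translate_u hji hju hjf hiu hif huf p hdp hd2 s hq (fun e he hef => (hled e he hef).1) β hc, hflag]
  have hzero := line_eq_zero_of_hasse_vanish hji hju hjf hiu hif huf s.F (d + 3) 2 c β (d - 1 - c) htop hvan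
    (Finsupp.single j (a + 1) + Finsupp.single i 2 + Finsupp.single u (d - c - a) + Finsupp.single f c)
    (by rw [degree_quad]; omega) hKi hKf
  exact hkill hzero

/-! ## 3. A `κ`-killer survives every `o`-step -/

/-- **A `κ`-KILLER SURVIVES EVERY `o`-STEP** (`d + 1 = p`, `2 ≤ d`): with the exact ledger, the coefficient of `x_j^{a+1}x_i²x_u^{d−c−a}x_f^c`
(`a ≤ d − c`, `c + 1 ≤ d`) is carried by the slot step in the chart of the OTHER slot `i` translated by ANY `β′·e_u` (it is the top of its
`o`-line).  With §2: once a `κ`-killer is born the chain takes the chart `o` for ever. [OURS] [cite: Hauser2010, §§F–G] -/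
theorem coeff_killer_step_translate_other (p : ℕ) [hp : Fact p.Prime] {d : ℕ} (hdp : d + 1 = p) (hd2 : 2 ≤ d) (s : State K)
    (hq : ((p : ℕ) : ℕ∞) ≤ ordAlong Finset.univ s.F) (hled : ∀ e ∈ s.F.support, e f ≤ d - 1 → 2 ≤ e j ∧ 2 ≤ e i)
    {a c : ℕ} (hac : a ≤ d - c) (hc : c + 1 ≤ d) (β' : K) :
    coeff (Finsupp.single j (a + 1) + Finsupp.single i 2 + Finsupp.single u (d - c - a) + Finsupp.single f c)
        (CentreBlowup.step p Finset.univ i (Function.update (0 : Fin 4 → K) u β') s).F =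
      coeff (Finsupp.single j (a + 1) + Finsupp.single i 2 + Finsupp.single u (d - c - a) + Finsupp.single f c) s.F := by
  have hp3 : 3 ≤ p := by have := hp.out.two_le; omega
  obtain ⟨hKj, hKi, hKu, hKf⟩ := quad_apply hji hju hjf hiu hif huf (a + 1) 2 (d - c - a) c
  refine coeff_top_step_translate_u hji.symm hiu hif hju hjf huf p s hq β' hKi (by rw [degree_quad]; omega) ?_ ?_
  · rw [isPthPowerExponent_iff]
    intro h
    have := Nat.le_of_dvd (by norm_num) (hKi ▸ h i)
    omega
  · intro δ hδ _ _ hf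
    exact (hled δ hδ (by rw [hf, hKf]; omega)).2

end Step

end ResCone

end Summit.ResolutionOfSingularities.ResolutionOfSingularities.Theorems.PIDim4
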